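import Literature.NumberTheory.GaloisCohomology.RestrictedRamificationExtComparisonLocalization
import Literature.NumberTheory.GaloisRepresentations.TateDualHomUnits
import Literature.NumberTheory.GaloisRepresentations.IdeleProjectionSTrunc
import Literature.NumberTheory.GaloisRepresentations.IdeleTruncatedSUnitsSequence
import Literature.NumberTheory.GaloisRepresentations.IdeleTruncatedSLocalization
import Literature.Algebra.Homology.DiscreteRepExtInternalHomPrecomp
import HarnessLib

/-!
# The local identification `e_v : (M^D)|_{Γ_{K_v}} ≅ Hom(φ_v^* M^{N_S}, K̄_vˣ)` of the (Λ1) square and its compatibility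
# `hg` with `e_S` along `Ē_S → Ī_S → K̄_vˣ` (Milne ADT I §0 (0.8), Lemma 4.13; Harari Prop. 17.26)

Topic `NumberTheory/GaloisCohomology`; namespace `Literature.NumberTheory.GaloisCohomology.RestrictedExt`.  Definitions with
bodies (isomorphisms / morphisms of `C_{Γ_{K_v}}`, the map `Λ_v`) and theorems; no named fact, no global instance (two
`attribute [local instance]`: the `Module.Finite` theorem of the prequel and compactness of `Γ_{K_w}`), no notation, no `sorry`.  Sequel of `RestrictedRamificationExtComparisonLocalization` (bsd-eis -w7 g13, P4:
`restrictedLocalization_extAddEquivRestrictedCohomologyTateDual`, the (Λ1)-shaped square with the local data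
`(G, c, eH, hg)` displayed) supplying that local data for the lane's coefficients: `G := K̄_vˣ`
(`ofDiscreteGaloisModule (units K_v)`, -w4 g20's `unitsD`), `c := φ_v^*(Ē_S → Ī_S) ≫ π_v^S` (-w6's `sUnitsToTruncD`, -w4's
`finIdelePiSD`), `eH := tateDualLocalUnitsIsoD` (the tree's `HomDual.tateDualLocalUnitsIso`, `f ↦ (m ↦ ι_v (f m))`, read in
`C_{Γ_{K_v}}` and precomposed with `φ_v^* M^{N_S} ≅ M|_{Γ_{K_v}}`), and PROVING `hg` (the two ways from `(M^D)^{N_S}` to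
`Hom(M^{N_S}, K̄_vˣ)` agree: `ι_v (f m) = π_v^S((f m)^{(S)})`, door-c6's «`π_v` is `ι_v` on principal idèles»
`finIdelePi_unitsToIdele` + -w6's `finIdelePiS_unitsToTruncKS`).  Result: **`restrictedLocalization_cmp_eq_cmpLocal`** — for
`v ∈ S`, `loc_v (cmp y) = cmp_v (φ_v^* y ∘ c_v)` with NO displayed hypothesis left: the `cmp`-half of (Λ1) of
`PoitouTateRestrictedShaTwoLocalCriterion` for `Λ_v := cmp_v ∘ (φ_v^*(·) ∘ π_v^S)`.
HONEST FRAMING: bookkeeping between existing identifications; no duality theorem and no case of BSD is proved here.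

## References
* J. S. Milne, *Arithmetic Duality Theorems*, 2nd ed. (2006), I §0 (0.8), I §4 Lemma 4.12, Lemma 4.13, proof of
  Thm. 4.10 (a) (p. 58). [MilneADT2006]
* D. Harari, *Galois Cohomology and Class Field Theory*, Universitext (2020), Lemma 17.21 (a), Prop. 17.26 (proof),
  §17.2 (p. 290). [Harari2020]
-/

noncomputable section

open CategoryTheory CategoryTheory.Abelian NumberField Field IsDedekindDomain
open Literature.Algebra.Homology Literature.Algebra.Homology.DiscreteRep
open Literature.NumberTheory.GaloisRepresentations
open Literature.NumberTheory.GaloisRepresentations.DiscreteGaloisModule (units UnitsCarrier TateDual)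
open scoped NumberField

namespace Literature.NumberTheory.GaloisCohomology

namespace RestrictedExt

attribute [local instance] moduleFinite_pullD_quotientInvariants

/-- `Γ_{K_w}` is compact for every place `w` of a number field (the tree's `absoluteGaloisGroup_compactSpace`), recorded as a
local instance so that the statements below quantify over the place without an instance binder. [cite: Harari2020, §4.2] -/
theorem compactSpace_absoluteGaloisGroup_completion (K : Type) [Field K] [NumberField K] (w : Place K) :
    CompactSpace (absoluteGaloisGroup (Place.Completion w)) :=
  absoluteGaloisGroup_compactSpace _

attribute [local instance] compactSpace_absoluteGaloisGroup_completion

section LocalIso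

variable (K : Type) [Field K] [NumberField K] (S : Set (HeightOneSpectrum (𝓞 K))) (n : ℕ) [NeZero n]
  {M : Type} [AddCommGroup M] [TopologicalSpace M] [DiscreteTopology M] [Finite M] (ρ : DiscreteGaloisModule K M)
  (v : HeightOneSpectrum (𝓞 K))

/-! ## §1 `φ_v^* ⟨M^{N_S}⟩ ≅ M|_{Γ_{K_v}}` for a `G_S`-module -/

omit [Finite M] in
/-- **`φ_v^* ⟨M^{N_S}⟩ ≅ ⟨M|_{Γ_{K_v}}⟩` in `C_{Γ_{K_v}}`** for `M` unramified outside `S` (`M^{N_S} = M`,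
`invariantsRamificationEquiv`; `Γ_{K_v}` acts on both through `res_v`). [cite: Harari2020, §17.2 (p. 290)] -/
def pullQuotientInvariantsIso (hur : ramificationSubgroup K S ≤ ContinuousRep.ker ρ) :
    (pullD ℤ (localizationHom K S (Sum.inr v))).obj (ofContinuousRep (ρ.quotientInvariants (ramificationSubgroup K S))) ≅
      ofDiscreteGaloisModule (ρ.toLocal (Sum.inr v)) where
  hom := ObjectProperty.homMk (Rep.ofHom
    { toLinearMap := (ρ.invariantsRamificationEquiv hur).toLinearMap
      isIntertwining' := fun _ => rfl })
  inv := ObjectProperty.homMk (Rep.ofHom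
    { toLinearMap := (ρ.invariantsRamificationEquiv hur).symm.toLinearMap
      isIntertwining' := fun _ => LinearMap.ext fun _ => Subtype.ext rfl })
  hom_inv_id := ObjectProperty.hom_ext _ (Rep.hom_ext (DFunLike.ext _ _ fun _ => Subtype.ext rfl))
  inv_hom_id := ObjectProperty.hom_ext _ (Rep.hom_ext (DFunLike.ext _ _ fun _ => rfl))

omit [Finite M] in
/-- Formula: `pullQuotientInvariantsIso.hom` is the inclusion `M^{N_S} ⊆ M`. [cite: Harari2020, §17.2 (p. 290)] -/
@[simp] theorem pullQuotientInvariantsIso_hom_apply (hur : ramificationSubgroup K S ≤ ContinuousRep.ker ρ)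
    (w : Representation.invariants (ρ.toRepresentation.comp (ramificationSubgroup K S).subtype)) :
    (pullQuotientInvariantsIso K S ρ v hur).hom.hom.hom w = (w : M) := rfl

/-- **`Hom(M|_{Γ_{K_v}}, G) ≅ Hom(φ_v^* ⟨M^{N_S}⟩, G)`** (pre-composition with `pullQuotientInvariantsIso`).
[cite: Harari2020, §16.2 (16.4)] -/
def ihomPullQuotientInvariantsIso (hur : ramificationSubgroup K S ≤ ContinuousRep.ker ρ)
    (G : DiscreteRepCat ℤ (absoluteGaloisGroup (Place.Completion (K := K) (Sum.inr v)))) :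
    ihomObj (ofDiscreteGaloisModule (ρ.toLocal (Sum.inr v))) G ≅
      ihomObj ((pullD ℤ (localizationHom K S (Sum.inr v))).obj
        (ofContinuousRep (ρ.quotientInvariants (ramificationSubgroup K S)))) G where
  hom := ihomPrecomp (pullQuotientInvariantsIso K S ρ v hur).hom G
  inv := ihomPrecomp (pullQuotientInvariantsIso K S ρ v hur).inv G
  hom_inv_id := ObjectProperty.hom_ext _ (Rep.hom_ext (DFunLike.ext _ _ fun _ => rfl))
  inv_hom_id := ObjectProperty.hom_ext _ (Rep.hom_ext (DFunLike.ext _ _ fun _ => rfl))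

/-! ## §2 `e_v : (M^D)|_{Γ_{K_v}} ≅ Hom(φ_v^* ⟨M^{N_S}⟩, K̄_vˣ)` -/

/-- The tree's `tateDualLocalUnitsIso` (`(M^D)|_{Γ_{K_v}} ≅ Hom_ℤ(M|_{Γ_{K_v}}, K̄_vˣ)` in `TopRep`) read in `C_{Γ_{K_v}}`:
`stdBase ((M^D)|_{Γ_{K_v}}) ≅ ihomObj ⟨M|_{Γ_{K_v}}⟩ ⟨K̄_vˣ⟩`. [cite: MilneADT2006, I §0 (0.8), I §2] -/
def tateDualLocalUnitsIsoD₀ (hM : ∀ m : M, n • m = 0) :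
    stdBase (((ρ.tateDual n).toLocal (Sum.inr v)).toTopRep) (isDiscrete_of_continuousRep ((ρ.tateDual n).toLocal (Sum.inr v))) ≅
      ihomObj (ofDiscreteGaloisModule (ρ.toLocal (Sum.inr v)))
        (ofDiscreteGaloisModule (units (Place.Completion (K := K) (Sum.inr v)))) :=
  (DiscreteRep.isDiscrete ℤ (absoluteGaloisGroup (Place.Completion (K := K) (Sum.inr v)))).isoMk
    ((forgetTop ℤ (absoluteGaloisGroup (Place.Completion (K := K) (Sum.inr v)))).mapIso
      (HomDual.tateDualLocalUnitsIso v ρ n hM))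

/-- Elementwise, down to `K̄_vˣ`: `(e₀ f) m = ι_v (f m)`. [cite: MilneADT2006, I §0 (0.8)] -/
theorem unitsVal_tateDualLocalUnitsIsoD₀_hom_apply (hM : ∀ m : M, n • m = 0) (f : TateDual K M n) (m : M) :
    unitsVal (v.adicCompletion K)
        ((show M →ₗ[ℤ] UnitsCarrier (v.adicCompletion K) from (tateDualLocalUnitsIsoD₀ K n ρ v hM).hom.hom.hom f) m) =
      Units.map (absClosureEmbedding K (v.adicCompletion K) : AlgebraicClosure K →* AlgebraicClosure (v.adicCompletion K))
        (muVal K n (f m)) :=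
  HomDual.unitsVal_tateDualLocalUnitsIso_hom_apply v ρ n hM f m

/-- **`e_v : stdBase ((M^D)|_{Γ_{K_v}}) ≅ ihomObj (φ_v^* ⟨M^{N_S}⟩) ⟨K̄_vˣ⟩`** — the `eH` of
`restrictedLocalization_extAddEquivRestrictedCohomologyTateDual` for the coefficients `K̄_vˣ`.
[cite: MilneADT2006, I §0 (0.8), I Lemma 4.13][cite: Harari2020, Lemma 17.21 (a)] -/
def tateDualLocalUnitsIsoD (hM : ∀ m : M, n • m = 0) (hur : ramificationSubgroup K S ≤ ContinuousRep.ker ρ) :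
    stdBase (((ρ.tateDual n).toLocal (Sum.inr v)).toTopRep) (isDiscrete_of_continuousRep ((ρ.tateDual n).toLocal (Sum.inr v))) ≅
      ihomObj ((pullD ℤ (localizationHom K S (Sum.inr v))).obj
          (ofContinuousRep (ρ.quotientInvariants (ramificationSubgroup K S))))
        (ofDiscreteGaloisModule (units (Place.Completion (K := K) (Sum.inr v)))) :=
  tateDualLocalUnitsIsoD₀ K n ρ v hM ≪≫
    ihomPullQuotientInvariantsIso K S ρ v hur (ofDiscreteGaloisModule (units (Place.Completion (K := K) (Sum.inr v))))

/-- Elementwise: `(e_v f) m = ι_v (f m)` for `m ∈ M^{N_S}`. [cite: MilneADT2006, I §0 (0.8)] -/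
theorem unitsVal_tateDualLocalUnitsIsoD_hom_apply (hM : ∀ m : M, n • m = 0)
    (hur : ramificationSubgroup K S ≤ ContinuousRep.ker ρ) (f : TateDual K M n)
    (m : Representation.invariants (ρ.toRepresentation.comp (ramificationSubgroup K S).subtype)) :
    unitsVal (v.adicCompletion K)
        ((show _ →ₗ[ℤ] UnitsCarrier (v.adicCompletion K) from (tateDualLocalUnitsIsoD K S n ρ v hM hur).hom.hom.hom f) m) =
      Units.map (absClosureEmbedding K (v.adicCompletion K) : AlgebraicClosure K →* AlgebraicClosure (v.adicCompletion K))
        (muVal K n (f (m : M))) :=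
  HomDual.unitsVal_tateDualLocalUnitsIso_hom_apply v ρ n hM f m

/-- **`n •` is onto `K̄_vˣ`** (Kummer: `K̄_v` is algebraically closed) — the hypothesis `hGm` of the local comparison.
[cite: MilneADT2006, I §0 (0.8)] -/
theorem exists_eq_nsmul_units (x : (ofDiscreteGaloisModule (units (Place.Completion (K := K) (Sum.inr v)))).obj.V) :
    ∃ y, x = n • y := by
  obtain ⟨y, hy⟩ := (isSES_kummer (Place.Completion (K := K) (Sum.inr v)) n (NeZero.pos n)).surjective x
  refine ⟨y, ?_⟩
  rw [← hy, kummerπ_hom_apply, natCast_zsmul]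

end LocalIso

/-! ## §3 The local coefficient map `c_v := φ_v^*(Ē_S → Ī_S) ≫ π_v^S` and the compatibility `hg` -/

section Coeff

variable (K : Type) [Field K] [NumberField K] (S : Finset (HeightOneSpectrum (𝓞 K))) (n : ℕ) [NeZero n]
  {M : Type} [AddCommGroup M] [TopologicalSpace M] [DiscreteTopology M] [Finite M] (ρ : DiscreteGaloisModule K M)
  (v : HeightOneSpectrum (𝓞 K))

/-- **`π_v^S` on the truncated principal idèle of an `S`-unit is `ι_v`** (`v ∈ S`): -w6's `finIdelePiS_unitsToTruncKS`
and door-c6's `finIdelePi_unitsToIdele`. [cite: Harari2020, Prop. 17.26 (proof)][cite: MilneADT2006, I Lemma 4.13 (proof)] -/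
theorem finIdelePiS_sUnitsToTruncD (hv : v ∈ S) (w : (IdeleClassBar.sUnitsKSD K S).obj.V) :
    IdeleReadout.finIdelePiS K S v ((IdeleClassBar.sUnitsToTruncD K S).hom.hom w) =
      HomDual.unitsTransferAddHom K (v.adicCompletion K)
        ((w.1 : SUnits.sUnitsSubmodule K (↑S : Set (HeightOneSpectrum (𝓞 K)))) : UnitsCarrier K) := by
  rw [IdeleClassBar.sUnitsToTruncD_hom_apply, IdeleClassBar.sUnitsToTruncAddHom_apply,
    IdeleClassBar.unitsToTruncKS_hom_apply, IdeleReadout.finIdelePiS_unitsToTruncKS K S hv,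
    IdeleReadout.finIdelePi_unitsToIdele, IdeleClassBar.coe_sUnitsToUnitsKS_apply, AddEquiv.apply_symm_apply]

/-- **`π_v^S : φ_v^* Ī_S ⟶ K̄_vˣ`** — -w4's `finIdelePiSD K S v`, with its source typed over `pullD ℤ (localizationHom …)` (the
same functor as `resDHom ℤ (decompMapS K S v) _` by `rfl`; the ascription keeps every `Ext.comp` below in one syntactic form).
[cite: Harari2020, Prop. 17.26][cite: MilneADT2006, I Lemma 4.13] -/
abbrev idelePiLoc :
    (pullD ℤ (localizationHom K (↑S : Set (HeightOneSpectrum (𝓞 K))) (Sum.inr v))).obj (IdeleClassBar.truncIdeleBarD K S) ⟶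
      ofDiscreteGaloisModule (units (Place.Completion (K := K) (Sum.inr v))) :=
  IdeleReadout.finIdelePiSD K S v

/-- **The local coefficient map `c_v : φ_v^* ⟨Ē_S⟩ ⟶ ⟨K̄_vˣ⟩` in `C_{Γ_{K_v}}`**: pull-back of `Ē_S → Ī_S` (-w6's
`sUnitsToTruncD`) followed by the idèle projection `π_v^S` (-w4's `finIdelePiSD`).
[cite: Harari2020, §17.4 (17.1), Prop. 17.26][cite: MilneADT2006, I Lemma 4.13] -/
def localCoeff :
    (pullD ℤ (localizationHom K (↑S : Set (HeightOneSpectrum (𝓞 K))) (Sum.inr v))).obj (IdeleClassBar.sUnitsKSD K S) ⟶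
      ofDiscreteGaloisModule (units (Place.Completion (K := K) (Sum.inr v))) :=
  (pullD ℤ (localizationHom K (↑S : Set (HeightOneSpectrum (𝓞 K))) (Sum.inr v))).map (IdeleClassBar.sUnitsToTruncD K S) ≫
    idelePiLoc K S v

/-- Formula: `c_v w = π_v^S ((Ē_S → Ī_S) w)`. [cite: Harari2020, Prop. 17.26] -/
@[simp] theorem localCoeff_hom_hom_apply (w : (IdeleClassBar.sUnitsKSD K S).obj.V) :
    (localCoeff K S v).hom.hom w = IdeleReadout.finIdelePiS K S v ((IdeleClassBar.sUnitsToTruncD K S).hom.hom w) := rfl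

/-- **`hg`: `e_v` EXTENDS `e_S` ALONG `c_v`** (`v ∈ S`): for `f ∈ (M^D)^{N_S}` and `m ∈ M^{N_S}`, `ι_v (f m) = π_v^S((Ē_S → Ī_S)(ι (f m)))`
— the two routes `(M^D)^{N_S} → Hom(M^{N_S}, K̄_vˣ)` of the (Λ1) square agree.
[cite: MilneADT2006, I §0 (0.8), I Lemma 4.13 (proof)][cite: Harari2020, Prop. 17.26 (proof)] -/
theorem pullbackHomD_localizationCoeff_comp_tateDualLocalUnitsIsoD (hv : v ∈ S)
    (hn : ∀ w : HeightOneSpectrum (𝓞 K), ((n : ℕ) : 𝓞 K) ∈ w.asIdeal → w ∈ (↑S : Set (HeightOneSpectrum (𝓞 K))))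
    (hM : ∀ m : M, n • m = 0) (hur : ramificationSubgroup K (↑S : Set (HeightOneSpectrum (𝓞 K))) ≤ ContinuousRep.ker ρ) :
    pullbackHomD (localizationHom K (↑S : Set (HeightOneSpectrum (𝓞 K))) (Sum.inr v))
        (isDiscrete_quotientInvariants (ρ.tateDual n) (↑S : Set (HeightOneSpectrum (𝓞 K))))
        (isDiscrete_of_continuousRep ((ρ.tateDual n).toLocal (Sum.inr v)))
        (localizationCoeff (Sum.inr v) (ρ.tateDual n)) ≫
        (tateDualLocalUnitsIsoD K (↑S : Set (HeightOneSpectrum (𝓞 K))) n ρ v hM hur).hom =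
      (pullD ℤ (localizationHom K (↑S : Set (HeightOneSpectrum (𝓞 K))) (Sum.inr v))).map
          (tateDualSUnitsIsoD K (↑S : Set (HeightOneSpectrum (𝓞 K))) n ρ hn hM hur).hom ≫
        (pullIhomIso (localizationHom K (↑S : Set (HeightOneSpectrum (𝓞 K))) (Sum.inr v))
            (ofContinuousRep (ρ.quotientInvariants (ramificationSubgroup K (↑S : Set (HeightOneSpectrum (𝓞 K))))))
            (ofContinuousRep (SUnits.sUnitsRestricted K (↑S : Set (HeightOneSpectrum (𝓞 K)))))).hom ≫
          (ihomFunctor ((pullD ℤ (localizationHom K (↑S : Set (HeightOneSpectrum (𝓞 K))) (Sum.inr v))).obj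
            (ofContinuousRep (ρ.quotientInvariants (ramificationSubgroup K (↑S : Set (HeightOneSpectrum (𝓞 K)))))))).map
            (localCoeff K S v) := by
  refine ObjectProperty.hom_ext _ (Rep.hom_ext (DFunLike.ext _ _ fun f => LinearMap.ext fun m => ?_))
  apply unitsVal_injective (v.adicCompletion K)
  -- left: `ι_v (f m)`
  have hL := unitsVal_tateDualLocalUnitsIsoD_hom_apply K (↑S : Set (HeightOneSpectrum (𝓞 K))) n ρ v hM hur
    (f.1 : TateDual K M n) m
  -- right: `π_v^S ((Ē_S → Ī_S) (ι (f m))) = ι_v (ι (f m))` (`finIdelePiS_sUnitsToTruncD`), and `ι (f m)` has value `f m` in `K̄ˣ`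
  have hR := finIdelePiS_sUnitsToTruncD K S v hv
    ((show _ →ₗ[ℤ] _ from ContHomDual.tateDualToHomSUnits K (↑S : Set (HeightOneSpectrum (𝓞 K))) n ρ hn f) m)
  refine hL.trans ?_
  change _ = unitsVal (v.adicCompletion K) (IdeleReadout.finIdelePiS K S v
    ((IdeleClassBar.sUnitsToTruncD K S).hom.hom
      ((show _ →ₗ[ℤ] _ from ContHomDual.tateDualToHomSUnits K (↑S : Set (HeightOneSpectrum (𝓞 K))) n ρ hn f) m)))
  rw [hR, HomDual.unitsVal_unitsTransferAddHom, ← unitsVal_kummerInclAddHom]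
  rfl

end Coeff

/-! ## §4 The `cmp`-half of (Λ1) with everything discharged -/

section Final

variable (K : Type) [Field K] [NumberField K] (S : Finset (HeightOneSpectrum (𝓞 K))) (n : ℕ) [NeZero n]
  {M : Type} [AddCommGroup M] [TopologicalSpace M] [DiscreteTopology M] [Finite M] (ρ : DiscreteGaloisModule K M)
  (v : HeightOneSpectrum (𝓞 K))

/-- **(Λ1), `cmp`-HALF, FULLY INSTANTIATED.**  For `K` a number field, `S` finite, `M` finite `n`-torsion unramified outside
`S ⊇ S_n`, `v ∈ S`, and `y ∈ Extʳ_{C_{G_S}}(⟨M^{N_S}⟩, ⟨Ē_S⟩)`: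
`loc_v (cmp y) = cmp_v (φ_v^* y ∘ c_v)` in `Hʳ(K_v, M^D)`, where `cmp = extAddEquivRestrictedCohomologyTateDual` (Harari 17.21 (a)
at `G_S`), `cmp_v = extAddEquivContinuousCohomologyOfTorsion … e_v` (the same comparison at `Γ_{K_v}` with coefficients `K̄_vˣ`),
`c_v = localCoeff` and `loc_v = restrictedLocalization (ρ.tateDual n) S (Sum.inr v) r`.  With `Λ_v z := cmp_v (φ_v^* z ∘ π_v^S)` this
is hypothesis (Λ1) of `PoitouTateRestrictedShaTwoLocalCriterion` (`φ_v^*(y ∘ T.f) ∘ π_v^S = φ_v^* y ∘ c_v` by functoriality).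
[cite: MilneADT2006, I Lemma 4.13, Thm. 4.10 (a) (proof, p. 58)][cite: Harari2020, Lemma 17.21 (a), Prop. 17.26] -/
theorem restrictedLocalization_cmp_eq_cmpLocal (hv : v ∈ S)
    (hn : ∀ w : HeightOneSpectrum (𝓞 K), ((n : ℕ) : 𝓞 K) ∈ w.asIdeal → w ∈ (↑S : Set (HeightOneSpectrum (𝓞 K))))
    (hM : ∀ m : M, n • m = 0) (hur : ramificationSubgroup K (↑S : Set (HeightOneSpectrum (𝓞 K))) ≤ ContinuousRep.ker ρ)
    (r : ℕ) (y : Ext (ofContinuousRep (ρ.quotientInvariants (ramificationSubgroup K (↑S : Set (HeightOneSpectrum (𝓞 K))))))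
      (ofContinuousRep (SUnits.sUnitsRestricted K (↑S : Set (HeightOneSpectrum (𝓞 K))))) r) :
    (ρ.tateDual n).restrictedLocalization (↑S : Set (HeightOneSpectrum (𝓞 K))) (Sum.inr v) r
        (extAddEquivRestrictedCohomologyTateDual K (↑S : Set (HeightOneSpectrum (𝓞 K))) n ρ hn hM hur r y) =
      extAddEquivContinuousCohomologyOfTorsion
        ((pullD ℤ (localizationHom K (↑S : Set (HeightOneSpectrum (𝓞 K))) (Sum.inr v))).obj
          (ofContinuousRep (ρ.quotientInvariants (ramificationSubgroup K (↑S : Set (HeightOneSpectrum (𝓞 K)))))))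
        (ofDiscreteGaloisModule (units (Place.Completion (K := K) (Sum.inr v))))
        (nsmul_obj_ofContinuousRep_quotientInvariants_eq_zero K (↑S : Set (HeightOneSpectrum (𝓞 K))) n ρ hM)
        (exists_eq_nsmul_units K n v)
        ((ρ.tateDual n).toLocal (Sum.inr v)).toTopRep (isDiscrete_of_continuousRep ((ρ.tateDual n).toLocal (Sum.inr v)))
        (tateDualLocalUnitsIsoD K (↑S : Set (HeightOneSpectrum (𝓞 K))) n ρ v hM hur) r
        ((y.mapExactFunctor (pullD ℤ (localizationHom K (↑S : Set (HeightOneSpectrum (𝓞 K))) (Sum.inr v)))).comp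
          (Ext.mk₀ (localCoeff K S v)) (add_zero r)) :=
  restrictedLocalization_extAddEquivRestrictedCohomologyTateDual K (↑S : Set (HeightOneSpectrum (𝓞 K))) n ρ (Sum.inr v)
    hn hM hur (ofDiscreteGaloisModule (units (Place.Completion (K := K) (Sum.inr v)))) (exists_eq_nsmul_units K n v)
    (localCoeff K S v) (tateDualLocalUnitsIsoD K (↑S : Set (HeightOneSpectrum (𝓞 K))) n ρ v hM hur)
    (pullbackHomD_localizationCoeff_comp_tateDualLocalUnitsIsoD K S n ρ v hv hn hM hur) r y

/-! ## §5 `Λ_v := cmp_v ∘ (φ_v^*(·) ∘ π_v^S)` and (Λ1) in the binder shape of `PoitouTateRestrictedShaTwoLocalCriterion` -/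

/-- **`cmp_v`**: the torsion comparison `Extʳ_{C_{Γ_{K_v}}}(φ_v^* ⟨M^{N_S}⟩, K̄_vˣ) ≃+ Hʳ(K_v, M^D)` through `e_v`
(`extAddEquivContinuousCohomologyOfTorsion` with `hGm := exists_eq_nsmul_units`, `eH := tateDualLocalUnitsIsoD`).
[cite: MilneADT2006, I §0 (0.8), Lemma 4.13][cite: Harari2020, Lemma 17.21 (a)] -/
abbrev cmpLocal (hM : ∀ m : M, n • m = 0) (hur : ramificationSubgroup K (↑S : Set (HeightOneSpectrum (𝓞 K))) ≤ ContinuousRep.ker ρ)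
    (r : ℕ) :
    Ext ((pullD ℤ (localizationHom K (↑S : Set (HeightOneSpectrum (𝓞 K))) (Sum.inr v))).obj
          (ofContinuousRep (ρ.quotientInvariants (ramificationSubgroup K (↑S : Set (HeightOneSpectrum (𝓞 K)))))))
        (ofDiscreteGaloisModule (units (Place.Completion (K := K) (Sum.inr v)))) r ≃+
      galoisCohomology ((ρ.tateDual n).toLocal (Sum.inr v)) r :=
  extAddEquivContinuousCohomologyOfTorsion
    ((pullD ℤ (localizationHom K (↑S : Set (HeightOneSpectrum (𝓞 K))) (Sum.inr v))).obj
      (ofContinuousRep (ρ.quotientInvariants (ramificationSubgroup K (↑S : Set (HeightOneSpectrum (𝓞 K)))))))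
    (ofDiscreteGaloisModule (units (Place.Completion (K := K) (Sum.inr v))))
    (nsmul_obj_ofContinuousRep_quotientInvariants_eq_zero K (↑S : Set (HeightOneSpectrum (𝓞 K))) n ρ hM)
    (exists_eq_nsmul_units K n v)
    ((ρ.tateDual n).toLocal (Sum.inr v)).toTopRep (isDiscrete_of_continuousRep ((ρ.tateDual n).toLocal (Sum.inr v)))
    (tateDualLocalUnitsIsoD K (↑S : Set (HeightOneSpectrum (𝓞 K))) n ρ v hM hur) r

/-- **`Λ_v : Extʳ_{C_{G_S}}(⟨M^{N_S}⟩, Ī_S) →+ Hʳ(K_v, M^D)`, `z ↦ cmp_v (φ_v^* z ∘ π_v^S)`** — the local map of Milne I Lemma 4.13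
at the place `v ∈ S` on the `Ext` road (Harari Prop. 17.25/17.26 composed with 17.21 (a) at `Γ_{K_v}`).
[cite: MilneADT2006, I Lemma 4.13][cite: Harari2020, Prop. 17.25, Prop. 17.26] -/
def lambdaLoc (hM : ∀ m : M, n • m = 0) (hur : ramificationSubgroup K (↑S : Set (HeightOneSpectrum (𝓞 K))) ≤ ContinuousRep.ker ρ)
    (r : ℕ) :
    Ext (ofContinuousRep (ρ.quotientInvariants (ramificationSubgroup K (↑S : Set (HeightOneSpectrum (𝓞 K))))))
        (IdeleClassBar.truncIdeleBarD K S) r →+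
      galoisCohomology ((ρ.tateDual n).toLocal (Sum.inr v)) r :=
  (cmpLocal K S n ρ v hM hur r).toAddMonoidHom.comp
    (((Ext.mk₀ (idelePiLoc K S v)).postcomp _ (add_zero r)).comp
      ((pullD ℤ (localizationHom K (↑S : Set (HeightOneSpectrum (𝓞 K))) (Sum.inr v))).mapExtAddHom _ _ r))

/-- Formula: `Λ_v z = cmp_v (φ_v^* z ∘ π_v^S)`. [cite: MilneADT2006, I Lemma 4.13] -/
theorem lambdaLoc_apply (hM : ∀ m : M, n • m = 0)
    (hur : ramificationSubgroup K (↑S : Set (HeightOneSpectrum (𝓞 K))) ≤ ContinuousRep.ker ρ) (r : ℕ)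
    (z : Ext (ofContinuousRep (ρ.quotientInvariants (ramificationSubgroup K (↑S : Set (HeightOneSpectrum (𝓞 K))))))
      (IdeleClassBar.truncIdeleBarD K S) r) :
    lambdaLoc K S n ρ v hM hur r z =
      cmpLocal K S n ρ v hM hur r
        ((z.mapExactFunctor (pullD ℤ (localizationHom K (↑S : Set (HeightOneSpectrum (𝓞 K))) (Sum.inr v)))).comp
          (Ext.mk₀ (idelePiLoc K S v)) (add_zero r)) := rfl

/-- **(Λ1) IN THE BINDER SHAPE OF `PoitouTateRestrictedShaTwoLocalCriterion`**: for `v ∈ S` and `y ∈ Extʳ(⟨M^{N_S}⟩, ⟨Ē_S⟩)`,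
`Λ_v (y ∘ T.f) = loc_v (cmp y)` with `T.f = sUnitsToTruncD K S` (`Ē_S → Ī_S`), `cmp = extAddEquivRestrictedCohomologyTateDual`,
`loc_v = restrictedLocalization (ρ.tateDual n) S (Sum.inr v) r`.  (The lane's closer applies it at `r = 2` to the module it
feeds `F`; any extra transport of `cmp`, e.g. -w2's biduality `RestrictedExtCmp.cmp`, commutes with `loc_v` by the naturality
of `restrictedLocalization` in the module.) [cite: MilneADT2006, I Lemma 4.13, Thm. 4.10 (a) (proof, p. 58)][cite: Harari2020, Prop. 17.26] -/
theorem lambdaLoc_comp_sUnitsToTruncD (hv : v ∈ S)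
    (hn : ∀ w : HeightOneSpectrum (𝓞 K), ((n : ℕ) : 𝓞 K) ∈ w.asIdeal → w ∈ (↑S : Set (HeightOneSpectrum (𝓞 K))))
    (hM : ∀ m : M, n • m = 0) (hur : ramificationSubgroup K (↑S : Set (HeightOneSpectrum (𝓞 K))) ≤ ContinuousRep.ker ρ)
    (r : ℕ) (y : Ext (ofContinuousRep (ρ.quotientInvariants (ramificationSubgroup K (↑S : Set (HeightOneSpectrum (𝓞 K))))))
      (ofContinuousRep (SUnits.sUnitsRestricted K (↑S : Set (HeightOneSpectrum (𝓞 K))))) r) :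
    lambdaLoc K S n ρ v hM hur r (y.comp (Ext.mk₀ (IdeleClassBar.sUnitsToTruncD K S)) (add_zero r)) =
      (ρ.tateDual n).restrictedLocalization (↑S : Set (HeightOneSpectrum (𝓞 K))) (Sum.inr v) r
        (extAddEquivRestrictedCohomologyTateDual K (↑S : Set (HeightOneSpectrum (𝓞 K))) n ρ hn hM hur r y) := by
  rw [restrictedLocalization_cmp_eq_cmpLocal K S n ρ v hv hn hM hur r y, lambdaLoc_apply]
  change cmpLocal K S n ρ v hM hur r _ = cmpLocal K S n ρ v hM hur r _
  congr 1
  rw [Ext.mapExactFunctor_comp, Ext.mapExactFunctor_mk₀, Ext.comp_assoc_of_second_deg_zero, Ext.mk₀_comp_mk₀]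
  rfl

set_option maxRecDepth 16384 in
/-- **(Λ1) PACKAGED FOR `cmp_comp_extClass_mem_shaRestricted` / `exists_cmp_comp_extClass_eq_of_mem_shaRestricted'`**: with
`T := IdeleClassBar.truncSeqS K S` (`Ē_S → Ī_S → C̄_S`, -w6), `A := ⟨M^{N_S}⟩`, `Λ v hv := lambdaLoc K S n ρ v hM hur 2` and
`cmp := extAddEquivRestrictedCohomologyTateDual K ↑S n ρ hn hM hur 2`, hypothesis `hΛ1` holds verbatim.
(`maxRecDepth` raised as in the lane's kit files: unfolding `truncSeqS` to `sUnitsToTruncD` is deep but definitional,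
`IdeleClassBar.truncSeqS_X₁` / `truncSeqS_f` are `rfl`.)
[cite: MilneADT2006, I Lemma 4.13, Thm. 4.10 (a) (proof, p. 58)][cite: Harari2020, Prop. 17.26] -/
theorem hΛ1_lambdaLoc
    (hn : ∀ w : HeightOneSpectrum (𝓞 K), ((n : ℕ) : 𝓞 K) ∈ w.asIdeal → w ∈ (↑S : Set (HeightOneSpectrum (𝓞 K))))
    (hM : ∀ m : M, n • m = 0) (hur : ramificationSubgroup K (↑S : Set (HeightOneSpectrum (𝓞 K))) ≤ ContinuousRep.ker ρ) :
    ∀ (v : HeightOneSpectrum (𝓞 K)) (hv : v ∈ (↑S : Set (HeightOneSpectrum (𝓞 K))))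
      (y : Ext (ofContinuousRep (ρ.quotientInvariants (ramificationSubgroup K (↑S : Set (HeightOneSpectrum (𝓞 K))))))
        (IdeleClassBar.truncSeqS K S).X₁ 2),
      lambdaLoc K S n ρ v hM hur 2 (y.comp (Ext.mk₀ (IdeleClassBar.truncSeqS K S).f) (add_zero 2)) =
        (ρ.tateDual n).restrictedLocalization (↑S : Set (HeightOneSpectrum (𝓞 K))) (Sum.inr v) 2
          (extAddEquivRestrictedCohomologyTateDual K (↑S : Set (HeightOneSpectrum (𝓞 K))) n ρ hn hM hur 2 y) :=
  fun v hv y => lambdaLoc_comp_sUnitsToTruncD K S n ρ v (Finset.mem_coe.1 hv) hn hM hur 2 y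

end Final

end RestrictedExt

end Literature.NumberTheory.GaloisCohomology

end
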